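import Literature.NumberTheory.GaloisRepresentations.HochschildSerreEdgeNaturality
import Literature.AnabelianGeometry.AbsoluteAnabelian.AbsTopIDeltaTwoNonTorsion
import HarnessLib

/-!
# [AbsTopI] Thm 2.6 (iii), proof p. 23: `δ²_l(Π) ≥ 1` from the Hochschild–Serre edge — the (M3) leg

S. Mochizuki, *Topics in Absolute Anabelian Geometry I: Generalities*, J. Math. Sci. Univ. Tokyo
**19** (2012) [AbsTopI], proof of Thm 2.6 (iii), p. 23: "Since `G` is of cohomological dimension 2
[...], and `δ²_l(G) = 0` for all `l ∈ Primes` [...], the spectral sequence associated to the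
surjection `Π ↠ G` yields [...] a pair of injections
`H¹(G, Hom(R_l, ℚ_l)) ↪ H¹(G, Hom(Δ^{ab-t}, ℚ_l)) ↪ H²(Π, ℚ_l)` [...].  Thus, by the injections
discussed above, we conclude that `ε²_{l′}(Π) ≥ δ²_{l′}(Π) ≥ 1`, so `l′ ∈ θ²(Π)`."

This file is the second injection, "`H¹(G, H¹(Δ, –)) ↪ H²(Π, –)` ⟹ `δ²_l(Π) ≥ 1`", RUN AT THE FINITE
LEVELS `ℤ/lⁱ` in the tree's continuous-cohomology vocabulary (abc-iut row «LEM27-HS-LOWDEG», the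
(M3) leg of GAP row G-w5d058g8-2 for `FundamentalExtension.Lem27iiiStep`):

* for a profinite `Π`, a closed normal `Δ`, a prime `l` and an integer `m` with `m • H²(Π/Δ, (ℤ/lⁱ)^Δ) = 0`
  and `H³(Π/Δ, (ℤ/lⁱ)^Δ) = 0` for all `i` (at `Π/Δ ≅ G_K`, `K` a finite extension of `ℚ_p`:
  `|H²(G_K, ℤ/lⁱ)| = |μ_{lⁱ}(K)|` divides `m = #μ_{l^∞}(K)`, and `cd G_K = 2` — print's "`δ²_l(G) = 0`"
  and "cohomological dimension 2"), the torsion-tolerant Hochschild–Serre edges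
  `e_i : H¹(Π/Δ, H¹(Δ, ℤ/lⁱ)) → H²(Π, ℤ/lⁱ)` (`hsEdgeTorsion`, kernel killed by `m`) are compatible with
  the reductions `ℤ/l^{i+1} → ℤ/lⁱ` (`cohomologyMap_hsEdgeTorsion`), so a COMPATIBLE family
  `z_i ∈ H¹(Π/Δ, H¹(Δ, ℤ/lⁱ))` whose orders are not bounded by any multiple of `m`
  (`∀ n ≥ 1, ∃ i, (m n) • z_i ≠ 0` — e.g. `z_i` of exact order `lⁱ`) gives a compatible family
  `e_i(z_i) ∈ H²(Π, ℤ/lⁱ)` of unbounded order, hence (`one_le_deltaInv_two_of_limitClasses_nonTorsion`,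
  abc-iut-w6-d073) a class of infinite order in `H²_cont(Π, ℤ_l)` and **`1 ≤ δ²_l(Π)`**
  (`one_le_deltaInv_two_of_hOneRep_family`);
* the card form of the torsion hypothesis (`nsmul_eq_zero_of_natCard_dvd`).

The first injection (Lemma 2.7 (iii), `H¹(G, Hom(R, –)) ↪ H¹(G, Hom(T, –))`) is abc-iut-w5-d058's
`AbsTopILem27Module` (`GModuleDatum.Quotient.lem27iii`); the production of the family `z_i` from the
geometric `G`-module datum (Lemma 2.7 (ii): `R` free of rank `r ≥ 1` with finite `G`-action ⇒ an
unramified `ℤ_l`-character gives classes of exact order `lⁱ` in `H¹(G_{H″}, Hom(R, ℤ/lⁱ)) ⊆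
H¹(Π/Δ, H¹(Δ, ℤ/lⁱ))`) and the identification of the coefficient modules `(ℤ/lⁱ)^Δ ≅ ℤ/lⁱ` over
`Π/Δ ≅ G_K` belong to the bridge «FACT ⇒ Lem27iiiStep» (GAP row G-w5d058g8-2), not here.

HONEST FRAMING: refereed, undisputed paper; classical Galois cohomology; nothing here bears on
[IUTchIII] Cor. 3.12; `Lem27iiiStep` itself stays a hypothesis on data until that bridge lands.

## References
* S. Mochizuki, *Topics in Absolute Anabelian Geometry I: Generalities* (2012), Thm 2.6 (iii), proof
  p. 23. [MochizukiAbsTopI2012]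
* J. Neukirch, A. Schmidt, K. Wingberg, *Cohomology of Number Fields*, 2nd ed. (2008), (2.4.1),
  (2.7.5)–(2.7.6). [NeukirchSchmidtWingberg2008]
-/

noncomputable section

open CategoryTheory Function Topology

namespace Literature.AnabelianGeometry.AbsoluteAnabelian

open Literature.NumberTheory.GaloisRepresentations
open _root_.TopRep _root_.ContRepresentation _root_.ContinuousCohomology

variable {P : Type} [Group P] [TopologicalSpace P] [IsTopologicalGroup P] [CompactSpace P] [T2Space P]
  [TotallyDisconnectedSpace P]
variable (Δ : Subgroup P) [Δ.Normal] [hΔ : IsClosed (Δ : Set P)]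
variable (l : ℕ) [Fact l.Prime]

/-- The trivial discrete `Π`-module `ℤ/lⁱ` as a `ContinuousRep` (so that `zmodRep Π l i` is its
`toTopRep` and the Hochschild–Serre edge files apply to it verbatim).
[cite: MochizukiAbsTopI2012, Thm 2.6 (iii) proof p.23] -/
abbrev zmodTrivRep (i : ℕ) : ContinuousRep P ℤ (ZMod (l ^ i)) :=
  ContinuousRep.trivial P ℤ (ZMod (l ^ i))

/-- Card form of the torsion hypothesis: if `#H²(Π/Δ, (ℤ/lⁱ)^Δ)` divides `m`, then `m` kills it
(at `Π/Δ ≅ G_K`: `#H²(G_K, ℤ/lⁱ) = #μ_{lⁱ}(K) ∣ #μ_{l^∞}(K)`).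
[cite: NeukirchSchmidtWingberg2008, Thm (7.2.6)] -/
theorem nsmul_eq_zero_of_natCard_dvd {X : Type*} [AddCommGroup X] [Finite X] {m : ℕ}
    (h : Nat.card X ∣ m) (x : X) : m • x = 0 :=
  addOrderOf_dvd_iff_nsmul_eq_zero.1 ((addOrderOf_dvd_natCard x).trans h)

/-- **The compatible family of `H²(Π, ℤ/lⁱ)`-classes** produced by the torsion-tolerant
Hochschild–Serre edges from a compatible family `z_i ∈ H¹(Π/Δ, H¹(Δ, ℤ/lⁱ))`: an element of
`lim_i H²(Π, ℤ/lⁱ)` (`padicIntTower.limitClasses`), by the naturality of the edge along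
`ℤ/l^{i+1} → ℤ/lⁱ` (`cohomologyMap_hsEdgeTorsion`). [cite: MochizukiAbsTopI2012, Thm 2.6 (iii) proof p.23] -/
def hsEdgeFamily (m : ℕ)
    (hm : ∀ (i : ℕ) (x : continuousCohomology 2 ((zmodTrivRep l i).quotientInvariants Δ).toTopRep),
      m • x = 0)
    [∀ i : ℕ, Subsingleton (continuousCohomology 3 ((zmodTrivRep (P := P) l i).quotientInvariants Δ).toTopRep)]
    (z : ∀ i : ℕ, continuousCohomology 1 (hOneRep Δ (zmodTrivRep (P := P) l i)).toTopRep)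
    (hz : ∀ i, cohomologyMap (hOneRepMap Δ (zmodTr P l i)) 1 (z (i + 1)) = z i) :
    (padicIntTower P l).limitClasses :=
  ⟨fun i => hsEdgeTorsion Δ (zmodTrivRep l i) m (hm i) (z i), fun i => by
    change cohomologyMap (zmodTr P l i) 2 (hsEdgeTorsion Δ (zmodTrivRep l (i + 1)) m (hm (i + 1))
      (z (i + 1))) = hsEdgeTorsion Δ (zmodTrivRep l i) m (hm i) (z i)
    rw [cohomologyMap_hsEdgeTorsion Δ (zmodTr P l i) m (hm (i + 1)) (hm i), hz i]⟩

/-- Components of `hsEdgeFamily`. [cite: MochizukiAbsTopI2012, Thm 2.6 (iii) proof p.23] -/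
@[simp] theorem hsEdgeFamily_coe_apply (m : ℕ)
    (hm : ∀ (i : ℕ) (x : continuousCohomology 2 ((zmodTrivRep l i).quotientInvariants Δ).toTopRep),
      m • x = 0)
    [∀ i : ℕ, Subsingleton (continuousCohomology 3 ((zmodTrivRep (P := P) l i).quotientInvariants Δ).toTopRep)]
    (z : ∀ i : ℕ, continuousCohomology 1 (hOneRep Δ (zmodTrivRep (P := P) l i)).toTopRep)
    (hz : ∀ i, cohomologyMap (hOneRepMap Δ (zmodTr P l i)) 1 (z (i + 1)) = z i) (i : ℕ) :
    (hsEdgeFamily Δ l m hm z hz).1 i = hsEdgeTorsion Δ (zmodTrivRep l i) m (hm i) (z i) := rfl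

/-- **The family `hsEdgeFamily z` has infinite order as soon as the orders of the `z_i` are not
bounded by any multiple of `m`** (the kernel of each edge is killed by `m`).
[cite: MochizukiAbsTopI2012, Thm 2.6 (iii) proof p.23] -/
theorem nsmul_hsEdgeFamily_ne_zero (m : ℕ)
    (hm : ∀ (i : ℕ) (x : continuousCohomology 2 ((zmodTrivRep l i).quotientInvariants Δ).toTopRep),
      m • x = 0)
    [∀ i : ℕ, Subsingleton (continuousCohomology 3 ((zmodTrivRep (P := P) l i).quotientInvariants Δ).toTopRep)]
    (z : ∀ i : ℕ, continuousCohomology 1 (hOneRep Δ (zmodTrivRep (P := P) l i)).toTopRep)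
    (hz : ∀ i, cohomologyMap (hOneRepMap Δ (zmodTr P l i)) 1 (z (i + 1)) = z i)
    (hord : ∀ n : ℕ, 0 < n → ∃ i, (m * n) • z i ≠ 0) (n : ℕ) (hn : 0 < n) :
    n • hsEdgeFamily Δ l m hm z hz ≠ 0 := by
  intro h0
  obtain ⟨i, hi⟩ := hord n hn
  apply hi
  apply mul_nsmul_eq_zero_of_nsmul_hsEdgeTorsion_eq_zero Δ (zmodTrivRep l i) m (hm i)
  have h : (n • hsEdgeFamily Δ l m hm z hz).1 i = (0 : (padicIntTower P l).limitClasses).1 i := by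
    rw [h0]
  rw [AddSubmonoidClass.coe_nsmul, Pi.smul_apply, hsEdgeFamily_coe_apply, ZeroMemClass.coe_zero,
    Pi.zero_apply] at h
  exact h

/-- **[AbsTopI] Thm 2.6 (iii), proof p. 23, the Hochschild–Serre step at the finite levels:
`δ²_l(Π) ≥ 1` from a compatible family of `E₂^{1,1}`-classes of unbounded order.**  For a profinite
`Π`, a closed normal subgroup `Δ`, a prime `l` and `m ∈ ℕ` with `m • H²(Π/Δ, (ℤ/lⁱ)^Δ) = 0` and
`H³(Π/Δ, (ℤ/lⁱ)^Δ) = 0` for every `i` ("`δ²_l(G) = 0`" and "`cd G = 2`" of print, `G = Π/Δ ≅ G_K`):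
if `z_i ∈ H¹(Π/Δ, H¹(Δ, ℤ/lⁱ))` is a family compatible under the reductions `ℤ/l^{i+1} → ℤ/lⁱ`
whose orders are not bounded by any multiple of `m` (`∀ n ≥ 1, ∃ i, (m n) • z_i ≠ 0`; e.g. `z_i` of
exact order `lⁱ`), then `dim_{ℚ_l} H²_cont(Π, ℚ_l) ≥ 1`, i.e. `1 ≤ deltaInv Π 2 l` — the conclusion
`1 ≤ δ²_l(H′)` of `FundamentalExtension.Lem27iiiStep` at `Π = H′`.
[cite: MochizukiAbsTopI2012, Thm 2.6 (iii) proof p.23] [cite: NeukirchSchmidtWingberg2008, (2.4.1)] -/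
theorem one_le_deltaInv_two_of_hOneRep_family (m : ℕ)
    (hm : ∀ (i : ℕ) (x : continuousCohomology 2 ((zmodTrivRep l i).quotientInvariants Δ).toTopRep),
      m • x = 0)
    [∀ i : ℕ, Subsingleton (continuousCohomology 3 ((zmodTrivRep (P := P) l i).quotientInvariants Δ).toTopRep)]
    (z : ∀ i : ℕ, continuousCohomology 1 (hOneRep Δ (zmodTrivRep (P := P) l i)).toTopRep)
    (hz : ∀ i, cohomologyMap (hOneRepMap Δ (zmodTr P l i)) 1 (z (i + 1)) = z i)
    (hord : ∀ n : ℕ, 0 < n → ∃ i, (m * n) • z i ≠ 0) :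
    1 ≤ deltaInv P 2 l :=
  one_le_deltaInv_two_of_limitClasses_nonTorsion l (hsEdgeFamily Δ l m hm z hz)
    (nsmul_hsEdgeFamily_ne_zero Δ l m hm z hz hord)

/-- Variant with the card form of the torsion hypothesis: `#H²(Π/Δ, (ℤ/lⁱ)^Δ) ∣ m` for all `i`
(finite groups), `H³ = 0`. [cite: MochizukiAbsTopI2012, Thm 2.6 (iii) proof p.23] -/
theorem one_le_deltaInv_two_of_hOneRep_family_of_natCard_dvd (m : ℕ)
    [∀ i : ℕ, Finite (continuousCohomology 2 ((zmodTrivRep (P := P) l i).quotientInvariants Δ).toTopRep)]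
    (hcard : ∀ i : ℕ,
      Nat.card (continuousCohomology 2 ((zmodTrivRep (P := P) l i).quotientInvariants Δ).toTopRep) ∣ m)
    [∀ i : ℕ, Subsingleton (continuousCohomology 3 ((zmodTrivRep (P := P) l i).quotientInvariants Δ).toTopRep)]
    (z : ∀ i : ℕ, continuousCohomology 1 (hOneRep Δ (zmodTrivRep (P := P) l i)).toTopRep)
    (hz : ∀ i, cohomologyMap (hOneRepMap Δ (zmodTr P l i)) 1 (z (i + 1)) = z i)
    (hord : ∀ n : ℕ, 0 < n → ∃ i, (m * n) • z i ≠ 0) :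
    1 ≤ deltaInv P 2 l :=
  one_le_deltaInv_two_of_hOneRep_family Δ l m (fun i x => nsmul_eq_zero_of_natCard_dvd (hcard i) x)
    z hz hord

end Literature.AnabelianGeometry.AbsoluteAnabelian

end
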